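import Mathlib.Algebra.Order.BigOperators.Group.Finset
import Mathlib.Data.Fintype.BigOperators
import Mathlib.Tactic.Ring
import Mathlib.Tactic.GCongr
import Mathlib.Tactic.NormNum
import Summits.PneNP.PneNP.Theorems.CodingVolumeShiftsCodingVolumeFlow

/-!
# Route CodingVolumeShifts — crux `CodingVolume` (stmt-PneNP-19454): rungs of the volume ladder

Kernel-checked cells of the ladder X = `CodingVolume`
(`∀ Δ C, ∃ L, ∀ N, N.DegLE Δ → N.Far L → Nonempty N.Code → C·k ≤ m`), on top of the information-flow
lemmas of `CodingVolumeShiftsCodingVolumeFlow` (rung `C = 2` lives there):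

* `codingVolume_exists_middle_arc`, `codingVolume_rung_three_arcs` — distance `3`:
  `(2Δ+1)·k ≤ Δ·m` (last-middle-arc charging: sink `i` is charged to the `x_i`-dependent arc two
  steps upstream, which joins two middle vertices; an arc is charged by `≤ Δ` sinks).
* `codingVolume_cut_bound` — the cut-set bound by injectivity: for every vertex set `U`, the arcs
  entering `U` number at least the commodities with sink in `U` and source outside `U`
  (`codingVolume_card_le_inArcs_sinks`: the cut around all sinks).
* `codingVolume_exists_dep_arcs` — at distance `L` every commodity has `≥ L` arcs whose bit
  depends on it (general, no degree bound: the upstream chain of dependent arcs from `sink i`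
  cannot reach `source i` in fewer than `L` steps).
* `codingVolume_dep_unique_of_inDeg_le_one`, `codingVolume_degOne_arcs`,
  `codingVolume_column_degOne` — the `Δ ≤ 1` COLUMN: with in-degrees `≤ 1` no arc depends on two
  commodities, so `L·k ≤ m` and `L := C` proves every cell `(Δ, C) = (1, C)`.

With `codingVolume_rung_two` (all `Δ`, `C ≤ 2`) the open cells of the ladder are exactly
`Δ ≥ 2, C ≥ 3` (route file: "C = 3 at Δ = 2 is the first open cell"). No definitions introduced;
"depends on `x_i`" is spelled out as in the Flow file. Route-independent (no Theses import).
-/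

set_option linter.dupNamespace false -- `Summit.PneNP.PneNP.…`: summit = sub-problem name (D-0017)

namespace Summit.PneNP.PneNP.Theorems

open Literature.InformationTheory.NetworkCoding Finset

section RungThree

variable {ι : Type} {N : KPairsNet ι}

/-- Every arc is an edge of the underlying undirected graph (its endpoints differ by acyclicity).
[folklore] -/
theorem codingVolume_adj_arc (a : N.A) : N.graph.Adj (N.src a) (N.tgt a) := by
  rw [KPairsNet.graph, SimpleGraph.fromRel_adj]
  exact ⟨fun h => absurd (N.rank_lt a) (by rw [h]; exact lt_irrefl _), Or.inl ⟨a, rfl, rfl⟩⟩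

/-- `Far` forbids short undirected walks between a source and its sink. [folklore] -/
theorem codingVolume_le_length_of_far {L : ℕ} {u v : N.V} (h : (L : ℕ∞) ≤ N.graph.edist u v)
    (p : N.graph.Walk u v) : L ≤ p.length := by
  exact_mod_cast h.trans (SimpleGraph.edist_le p)

/-- LAST-MIDDLE-ARC witness at distance `≥ 3`: if `source i`, `sink i` are at undirected distance
`≥ 3`, there are an arc `b` into `sink i` and an `x_i`-dependent arc `e` into the tail of `b` whose
own tail is not a source (so `e` runs between two middle vertices: its head `src b` is neither a
source nor a sink). [folklore] -/
theorem codingVolume_exists_middle_arc (c : N.Code) (i : ι)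
    (hfar : (3 : ℕ∞) ≤ N.graph.edist (N.source i) (N.sink i)) :
    ∃ e b : N.A, N.tgt b = N.sink i ∧ N.src b = N.tgt e ∧ (∀ j, N.src e ≠ N.source j) ∧
      (∀ j, N.tgt e ≠ N.sink j) ∧
      ¬ ∀ x x' : ι → Bool, (∀ j, j ≠ i → x j = x' j) → c.val e x = c.val e x' := by
  obtain ⟨b, hb, hdep⟩ := codingVolume_exists_dep_inArc_sink c i
  -- the tail of `b` is not a source
  have hbs : ∀ j, N.src b ≠ N.source j := by
    intro j hj
    by_cases hji : j = i
    · subst hji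
      have ha : N.graph.Adj (N.source j) (N.sink j) := by
        rw [← hj, ← hb]; exact codingVolume_adj_arc b
      have h1 := codingVolume_le_length_of_far (N := N) (L := 3) (by exact_mod_cast hfar)
        (SimpleGraph.Walk.cons ha SimpleGraph.Walk.nil)
      simp at h1
    · exact hdep (codingVolume_indep_of_src_source c hji b hj)
  rcases codingVolume_dep_upstream c i b hdep with hsrc | ⟨e, he, hedep⟩
  · exact absurd hsrc (hbs i)
  refine ⟨e, b, hb, he.symm, fun j hj => ?_, fun j => he ▸ N.sink_out b j, hedep⟩
  by_cases hji : j = i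
  · subst hji
    -- `source j → src b → sink j` would be an undirected walk of length 2
    have ha1 : N.graph.Adj (N.source j) (N.src b) := by
      rw [← hj, ← he]; exact codingVolume_adj_arc e
    have ha2 : N.graph.Adj (N.src b) (N.sink j) := by
      rw [← hb]; exact codingVolume_adj_arc b
    have h2 := codingVolume_le_length_of_far (N := N) (L := 3) (by exact_mod_cast hfar)
      (SimpleGraph.Walk.cons ha1 (SimpleGraph.Walk.cons ha2 SimpleGraph.Walk.nil))
    simp at h2
  · exact hedep (codingVolume_indep_of_src_source c hji e hj)

/-- **Rung at distance `3` (arc form): `(2Δ+1)·k ≤ Δ·m`.** In a k-pairs network with in/out-degrees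
`≤ Δ`, all pairs `3`-far and a binary one-shot code, besides the `k` source out-arcs and the `k`
non-source in-arcs of sinks there are at least `k/Δ` arcs between middle vertices: charge sink `i`
to the `x_i`-dependent middle arc two steps upstream (`codingVolume_exists_middle_arc`); an arc
`e` is charged only by sinks that are out-neighbours of its head, at most `Δ` of them. [folklore] -/
theorem codingVolume_rung_three_arcs [Fintype ι] (N : KPairsNet ι) {Δ : ℕ} (hΔ : N.DegLE Δ)
    (hfar : N.Far 3) (c : N.Code) : (2 * Δ + 1) * Fintype.card ι ≤ Δ * N.arcCount := by
  classical
  set S1 : Finset N.A := univ.filter fun a => ∃ i, N.src a = N.source i with hS1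
  set S2 : Finset N.A :=
    univ.filter fun a => (∃ i, N.tgt a = N.sink i) ∧ ∀ j, N.src a ≠ N.source j with hS2
  set M : Finset N.A :=
    univ.filter fun a => (∀ j, N.src a ≠ N.source j) ∧ ∀ j, N.tgt a ≠ N.sink j with hM
  have h12 : Disjoint S1 S2 := by
    rw [hS1, hS2, Finset.disjoint_filter]
    rintro a - ⟨i, hi⟩ ⟨-, hns⟩
    exact hns i hi
  have h1M : Disjoint S1 M := by
    rw [hS1, hM, Finset.disjoint_filter]
    rintro a - ⟨i, hi⟩ ⟨hns, -⟩
    exact hns i hi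
  have h2M : Disjoint S2 M := by
    rw [hS2, hM, Finset.disjoint_filter]
    rintro a - ⟨⟨i, hi⟩, -⟩ ⟨-, hnt⟩
    exact hnt i hi
  have hfar2 : N.Far 2 := fun i => le_trans (by exact_mod_cast (by norm_num : (2 : ℕ) ≤ 3)) (hfar i)
  choose f hf using fun i => codingVolume_exists_outArc_source c i
  choose g hg hgs using fun i => codingVolume_exists_inArc_sink_nonsource c i (hfar2 i)
  choose e b hb hbe hes het _hedep using fun i => codingVolume_exists_middle_arc c i (hfar i)
  have h1 : Fintype.card ι ≤ S1.card := by
    rw [← Finset.card_univ]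
    refine Finset.card_le_card_of_injOn f (fun i _ => ?_) (fun i _ i' _ h => ?_)
    · rw [Finset.mem_coe, hS1, Finset.mem_filter]
      exact ⟨Finset.mem_univ _, i, hf i⟩
    · exact N.source.injective ((hf i).symm.trans ((congrArg N.src h).trans (hf i')))
  have h2 : Fintype.card ι ≤ S2.card := by
    rw [← Finset.card_univ]
    refine Finset.card_le_card_of_injOn g (fun i _ => ?_) (fun i _ i' _ h => ?_)
    · rw [Finset.mem_coe, hS2, Finset.mem_filter]
      exact ⟨Finset.mem_univ _, ⟨i, hg i⟩, hgs i⟩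
    · exact N.sink.injective ((hg i).symm.trans ((congrArg N.tgt h).trans (hg i')))
  -- charging: the fibres of `e` have size `≤ Δ`
  have h3 : Fintype.card ι ≤ Δ * M.card := by
    have himg : (univ : Finset ι).image e ⊆ M := by
      intro a ha
      obtain ⟨i, -, rfl⟩ := Finset.mem_image.mp ha
      rw [hM, Finset.mem_filter]
      exact ⟨Finset.mem_univ _, hes i, het i⟩
    calc Fintype.card ι = (univ : Finset ι).card := Finset.card_univ.symm
      _ ≤ Δ * ((univ : Finset ι).image e).card := by
          refine Finset.card_le_mul_card_image _ Δ (fun a _ => ?_)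
          -- the sinks charged to `a` are heads of distinct out-arcs of `tgt a`
          calc ((univ : Finset ι).filter fun i => e i = a).card
              ≤ (N.outArcs (N.tgt a)).card := by
                refine Finset.card_le_card_of_injOn b (fun i hi => ?_) (fun i _ i' _ h => ?_)
                · rw [Finset.mem_coe, Finset.mem_filter] at hi
                  rw [Finset.mem_coe, KPairsNet.outArcs, Finset.mem_filter]
                  exact ⟨Finset.mem_univ _, by rw [hbe i, hi.2]⟩
                · exact N.sink.injective ((hb i).symm.trans ((congrArg N.tgt h).trans (hb i')))
            _ ≤ Δ := (hΔ _).2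
      _ ≤ Δ * M.card := Nat.mul_le_mul_left _ (Finset.card_le_card himg)
  have hunion : S1.card + S2.card + M.card ≤ N.arcCount := by
    have hd : Disjoint (S1.disjUnion S2 h12) M := by
      rw [Finset.disjoint_left]
      intro a ha haM
      rcases Finset.mem_disjUnion.mp ha with h | h
      · exact Finset.disjoint_left.mp h1M h haM
      · exact Finset.disjoint_left.mp h2M h haM
    calc S1.card + S2.card + M.card = ((S1.disjUnion S2 h12).disjUnion M hd).card := by
          rw [Finset.card_disjUnion, Finset.card_disjUnion]
      _ ≤ Fintype.card N.A := Finset.card_le_univ _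
      _ = N.arcCount := rfl
  calc (2 * Δ + 1) * Fintype.card ι = Δ * Fintype.card ι + Δ * Fintype.card ι + Fintype.card ι := by
        ring
    _ ≤ Δ * S1.card + Δ * S2.card + Δ * M.card := by gcongr
    _ = Δ * (S1.card + S2.card + M.card) := by ring
    _ ≤ Δ * N.arcCount := Nat.mul_le_mul_left _ hunion

end RungThree

section Cut

variable {ι : Type} {N : KPairsNet ι}

/-- CUT BOUND (injectivity of a one-shot code across a vertex cut). For every vertex set `U`, the
arcs ENTERING `U` are at least as many as the commodities whose sink lies in `U` and whose source
does not: with all other inputs hard-wired to `false`, the bits on the arcs entering `U` determine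
every bit inside `U` (locality, by rank induction) and hence those commodities (decodability) — an
injection `Bool^I ↪ Bool^cut`. (The cut-set bound, valid for coding; not the sparsity bound.)
[folklore] -/
theorem codingVolume_cut_bound [Fintype ι] (c : N.Code) (U : Finset N.V) :
    (univ.filter fun i => N.sink i ∈ U ∧ N.source i ∉ U).card ≤
      (univ.filter fun a => N.src a ∉ U ∧ N.tgt a ∈ U).card := by
  classical
  set I : Finset ι := univ.filter fun i => N.sink i ∈ U ∧ N.source i ∉ U with hI
  set cut : Finset N.A := univ.filter fun a => N.src a ∉ U ∧ N.tgt a ∈ U with hcut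
  -- inputs supported on `I`
  let ext : ({i // i ∈ I} → Bool) → (ι → Bool) := fun y j => if h : j ∈ I then y ⟨j, h⟩ else false
  let φ : ({i // i ∈ I} → Bool) → ({a // a ∈ cut} → Bool) := fun y a => c.val a.1 (ext y)
  have hφ : Function.Injective φ := by
    intro y y' h
    -- every arc with head in `U` carries the same bit on `ext y` and `ext y'`
    have hagree : ∀ a, N.tgt a ∈ U → c.val a (ext y) = c.val a (ext y') := by
      suffices hh : ∀ (r : ℕ) (a : N.A), N.rank (N.tgt a) = r → N.tgt a ∈ U →
          c.val a (ext y) = c.val a (ext y') from fun a => hh _ a rfl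
      intro r
      induction r using Nat.strong_induction_on with
      | _ r ih =>
        intro a hr haU
        by_cases hsrc : N.src a ∈ U
        · refine c.local_ a _ _ (fun b hb => ih _ ?_ b rfl (by rw [hb]; exact hsrc))
            (fun j hj => ?_)
          · rw [← hr, hb]; exact N.rank_lt a
          · have hj' : j ∉ I := by
              rw [hI, Finset.mem_filter]
              exact fun h => h.2.2 (by rw [hj]; exact hsrc)
            simp [ext, hj']
        · have ha : a ∈ cut := by
            rw [hcut, Finset.mem_filter]; exact ⟨Finset.mem_univ _, hsrc, haU⟩
          exact congrFun h ⟨a, ha⟩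
    funext ⟨i, hi⟩
    have hiU : N.sink i ∈ U := by
      have := hi; rw [hI, Finset.mem_filter] at this; exact this.2.1
    have key := c.decode i (ext y) (ext y') (fun b hb => hagree b (by rw [hb]; exact hiU))
    simpa [ext, hi] using key
  have h2 : 2 ^ I.card ≤ 2 ^ cut.card := by
    simpa [Fintype.card_fun, Fintype.card_bool, Fintype.card_coe] using
      Fintype.card_le_of_injective φ hφ
  exact (Nat.pow_le_pow_iff_right (by norm_num)).1 h2

/-- In particular (the cut around all sinks): a coded network has at least as many arcs into sinks
as commodities whose source is not itself a sink vertex — e.g. `k ≤ m` whenever no source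
coincides with a sink. [folklore] -/
theorem codingVolume_card_le_inArcs_sinks [Fintype ι] (c : N.Code) :
    (univ.filter fun i => ∀ j, N.source i ≠ N.sink j).card ≤
      (univ.filter fun a => ∃ j, N.tgt a = N.sink j).card := by
  classical
  have h := codingVolume_cut_bound c (univ.image N.sink)
  refine le_trans (Finset.card_le_card fun i hi => ?_) (h.trans (Finset.card_le_card fun a ha => ?_))
  · rw [Finset.mem_filter] at hi ⊢
    refine ⟨hi.1, Finset.mem_image_of_mem _ (Finset.mem_univ _), fun hs => ?_⟩
    obtain ⟨j, -, hj⟩ := Finset.mem_image.mp hs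
    exact hi.2 j hj.symm
  · rw [Finset.mem_filter] at ha ⊢
    obtain ⟨j, -, hj⟩ := Finset.mem_image.mp ha.2.2
    exact ⟨ha.1, j, hj.symm⟩

end Cut

section DegOne

variable {ι : Type} {N : KPairsNet ι}

/-- AT LEAST `L` DEPENDENT ARCS PER COMMODITY (no degree bound). If `source i`, `sink i` are at
undirected distance `≥ L`, then walking upstream from `sink i` along `x_i`-dependent arcs
(`codingVolume_dep_upstream`) cannot reach `source i` in fewer than `L` steps, so at least `L`
arcs (with pairwise distinct tail ranks) carry a bit that depends on `x_i`. [folklore] -/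
theorem codingVolume_exists_dep_arcs (c : N.Code) (i : ι) {L : ℕ}
    (hfar : (L : ℕ∞) ≤ N.graph.edist (N.source i) (N.sink i)) :
    ∃ s : Finset N.A, L ≤ s.card ∧
      ∀ a ∈ s, ¬ ∀ x x' : ι → Bool, (∀ j, j ≠ i → x j = x' j) → c.val a x = c.val a x' := by
  classical
  -- invariant after `t + 1` upstream steps: a dependent arc `a` whose head is joined to `sink i`
  -- by an undirected walk of length `≤ t`, and `t + 1` dependent arcs of tail rank `≥ rank (src a)`
  have key : ∀ t : ℕ, t + 1 ≤ L → ∃ a : N.A,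
      (¬ ∀ x x' : ι → Bool, (∀ j, j ≠ i → x j = x' j) → c.val a x = c.val a x') ∧
      (∃ p : N.graph.Walk (N.tgt a) (N.sink i), p.length ≤ t) ∧
      ∃ s : Finset N.A, t + 1 ≤ s.card ∧ ∀ b ∈ s,
        (¬ ∀ x x' : ι → Bool, (∀ j, j ≠ i → x j = x' j) → c.val b x = c.val b x') ∧
        N.rank (N.src a) ≤ N.rank (N.src b) := by
    intro t
    induction t with
    | zero =>
      intro _
      obtain ⟨b, hb, hdep⟩ := codingVolume_exists_dep_inArc_sink c i
      refine ⟨b, hdep, ⟨SimpleGraph.Walk.nil.copy hb.symm rfl, by simp⟩, {b}, by simp, ?_⟩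
      intro b' hb'
      rw [Finset.mem_singleton] at hb'
      subst hb'
      exact ⟨hdep, le_rfl⟩
    | succ t ih =>
      intro ht
      obtain ⟨a, hdep, ⟨p, hp⟩, s, hs, hmem⟩ := ih (by omega)
      rcases codingVolume_dep_upstream c i a hdep with hsrc | ⟨a', ha', hdep'⟩
      · -- the tail of `a` is `source i`: a walk of length `≤ t + 1 < L` joins the pair
        have hw := codingVolume_le_length_of_far hfar
          ((SimpleGraph.Walk.cons (codingVolume_adj_arc a) p).copy hsrc rfl)
        simp only [SimpleGraph.Walk.length_copy, SimpleGraph.Walk.length_cons] at hw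
        omega
      have hlt : N.rank (N.src a') < N.rank (N.src a) := by
        rw [← ha']; exact N.rank_lt a'
      refine ⟨a', hdep', ⟨(SimpleGraph.Walk.cons (codingVolume_adj_arc a) p).copy ha'.symm rfl,
        ?_⟩, insert a' s, ?_, ?_⟩
      · simp only [SimpleGraph.Walk.length_copy, SimpleGraph.Walk.length_cons]
        omega
      · have hnot : a' ∉ s := fun h => by
          have h1 := (hmem a' h).2
          omega
        rw [Finset.card_insert_of_notMem hnot]
        omega
      · intro b hb
        rw [Finset.mem_insert] at hb
        rcases hb with rfl | hb
        · exact ⟨hdep', le_rfl⟩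
        · exact ⟨(hmem b hb).1, (hlt.trans_le (hmem b hb).2).le⟩
  cases L with
  | zero => exact ⟨∅, by simp, by simp⟩
  | succ L =>
    obtain ⟨a, -, -, s, hs, hmem⟩ := key L le_rfl
    exact ⟨s, hs, fun b hb => (hmem b hb).1⟩

/-- IN-DEGREE `≤ 1`: NO ARC SERVES TWO COMMODITIES. If every vertex has at most one in-arc, an arc
whose bit depends on `x_i` depends on no other `x_j`: upstream of it the information travels along
a single chain of arcs, which starts at `source i`. [folklore] -/
theorem codingVolume_dep_unique_of_inDeg_le_one (c : N.Code)
    (hΔ : ∀ v, (N.inArcs v).card ≤ 1) (a : N.A) {i j : ι}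
    (hi : ¬ ∀ x x' : ι → Bool, (∀ l, l ≠ i → x l = x' l) → c.val a x = c.val a x')
    (hj : ¬ ∀ x x' : ι → Bool, (∀ l, l ≠ j → x l = x' l) → c.val a x = c.val a x') : i = j := by
  suffices h : ∀ (r : ℕ) (a : N.A), N.rank (N.src a) = r →
      (¬ ∀ x x' : ι → Bool, (∀ l, l ≠ i → x l = x' l) → c.val a x = c.val a x') →
      (¬ ∀ x x' : ι → Bool, (∀ l, l ≠ j → x l = x' l) → c.val a x = c.val a x') → i = j from
    h _ a rfl hi hj
  intro r
  induction r using Nat.strong_induction_on with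
  | _ r ih =>
    intro a hr hi hj
    by_contra hij
    rcases codingVolume_dep_upstream c i a hi with hsrc | ⟨a', ha', hdep'⟩
    · -- `a` leaves `source i`, so it does not depend on `x_j`
      exact hj (codingVolume_indep_of_src_source c hij a hsrc)
    · -- `a'` is THE in-arc of the tail of `a`; it must depend on `x_j` as well
      have hj' : ¬ ∀ x x' : ι → Bool, (∀ l, l ≠ j → x l = x' l) → c.val a' x = c.val a' x' := by
        intro hindep
        apply hj
        intro x x' hx
        refine c.local_ a x x' (fun b hb => ?_) (fun l hl => ?_)
        · have hba : b = a' :=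
            Finset.card_le_one.mp (hΔ (N.src a)) b (by simp [KPairsNet.inArcs, hb]) a'
              (by simp [KPairsNet.inArcs, ha'])
          rw [hba]
          exact hindep x x' hx
        · exact absurd (ha'.trans hl.symm) (N.source_in a' l)
      have hlt : N.rank (N.src a') < r := by
        rw [← hr, ← ha']; exact N.rank_lt a'
      exact hij (ih _ hlt a' rfl hdep' hj')

/-- **The `Δ ≤ 1` column of `CodingVolume` (arc form): `L·k ≤ m`.** With in/out-degrees `≤ 1`,
all pairs `L`-far and a binary one-shot code, the `k` sets of `≥ L` `x_i`-dependent arcs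
(`codingVolume_exists_dep_arcs`) are pairwise disjoint (`codingVolume_dep_unique_of_inDeg_le_one`),
so the network has at least `L·k` arcs — the routing volume, i.e. coding gains nothing at
degree `1`. [folklore] -/
theorem codingVolume_degOne_arcs [Fintype ι] (N : KPairsNet ι) (hΔ : N.DegLE 1) {L : ℕ}
    (hfar : N.Far L) (c : N.Code) : L * Fintype.card ι ≤ N.arcCount := by
  classical
  choose s hs hdep using fun i => codingVolume_exists_dep_arcs c i (hfar i)
  have hdisj : (↑(univ : Finset ι) : Set ι).PairwiseDisjoint s := by
    intro i _ j _ hij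
    rw [Function.onFun, Finset.disjoint_left]
    intro a hai haj
    exact hij (codingVolume_dep_unique_of_inDeg_le_one c (fun v => (hΔ v).1) a (hdep i a hai)
      (hdep j a haj))
  calc L * Fintype.card ι = ∑ _i : ι, L := by simp [mul_comm]
    _ ≤ ∑ i, (s i).card := Finset.sum_le_sum fun i _ => hs i
    _ = ((univ : Finset ι).biUnion s).card := (Finset.card_biUnion hdisj).symm
    _ ≤ Fintype.card N.A := Finset.card_le_univ _
    _ = N.arcCount := rfl

/-- **The `Δ ≤ 1` column of `CodingVolume` (crux stmt-PneNP-19454) in the shape of the crux:**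
for every constant `C` the distance `L := C` forces `C·k ≤ m` on all networks with in/out-degrees
`≤ 1` (`∀ C, ∃ L, …` with `Δ` fixed to `1`; together with `codingVolume_rung_two` the open cells of
the ladder are `Δ ≥ 2, C ≥ 3`). [folklore] -/
theorem codingVolume_column_degOne : ∀ C : ℕ, ∃ L : ℕ, ∀ (ι : Type) [Fintype ι]
    (N : KPairsNet ι), N.DegLE 1 → N.Far L → Nonempty N.Code → C * Fintype.card ι ≤ N.arcCount :=
  fun C => ⟨C, fun _ _ N hΔ hfar hc => hc.elim fun c => codingVolume_degOne_arcs N hΔ hfar c⟩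

end DegOne

end Summit.PneNP.PneNP.Theorems
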